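import Summits.AtomisticToContinuum.Crystallization.Theorems.ExcessDecayLiouvilleEnvelopeMasses
import Summits.AtomisticToContinuum.Crystallization.Theorems.ExcessDecayLiouvilleLevelMasses
import Summits.AtomisticToContinuum.Crystallization.Theorems.ExcessDecayLiouvilleVerticalDifferences

/-!
# Route `ExcessDecayLiouville`: local masses of the next step field (nonlinear half, XXXVIII)

Harmonic-replacement architecture for item `ExcessDecay` (stmt-AtomisticToContinuum-9334), nonlinear half.
The scale induction carries the step field `v = χ(u − aff)` through its LOCAL MASSES `𝐌[v, X]`.  After one
step the approximant changes by the increment `T + 𝟙_{S₀}ξ` (Taylor data `aᵀ, Bᵀ` based at a site `p₀` near the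
centre, sublattice shift `ξ`) and the new step field is `v′ = v − χ·(T + 𝟙_{S₀}ξ)`; its masses are bounded
* near the centre (`X ≤ ρ`, inside the quartic pointwise envelope of `v′ + w`) by `fresh_mass_le`:
  `𝐌[v′, X] ≤ 2·32X³(3(K(X + 11/10)²)² + 3‖ξ‖²) + 2W` — the Dirichlet correction `w` enters ONLY through
  `Σ'‖w‖² ≤ W`, never pointwise;
* away from the centre by `mass_sub_le_split` (`‖x − y‖² ≤ (1+η)‖x‖² + (1+η⁻¹)‖y‖²` summed) and the mass of the
  cut-off increment `incr_mass_le`: `𝐌[χ·(T + 𝟙ξ), X] ≤ 32X³(Vₐ + ‖ξ‖ + ‖Bᵀ‖(X + 11/10))²`.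
Also the pointwise value of `v′` at a central SITE (`central_value_le`, used at the last scale only).
All `[folklore]`; helper lemmas, nothing here closes an item.
-/

noncomputable section

namespace Summit.AtomisticToContinuum.Crystallization.Theorems.ExcessDecayLiouville

open scoped BigOperators Topology Classical
open Literature.MathematicalPhysics.StatisticalMechanics
open Summit.AtomisticToContinuum.Crystallization.Theorems.PhononStabilityNegative

set_option quotPrecheck false in
-- Local notation: ball indicator.
local notation "𝟙ᵇ[" x ", " c ", " R "]" => (if dist (x : EuclideanSpace ℝ (Fin 3)) c ≤ R then (1 : ℝ) else 0)

/-- `‖x − y‖² ≤ (1 + η)‖x‖² + (1 + η⁻¹)‖y‖²` for `η > 0`. [folklore] -/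
theorem norm_sub_sq_le_eta (x y : EuclideanSpace ℝ (Fin 3)) {η : ℝ} (hη : 0 < η) :
    ‖x - y‖ ^ 2 ≤ (1 + η) * ‖x‖ ^ 2 + (1 + η⁻¹) * ‖y‖ ^ 2 := by
  have h1 : ‖x - y‖ ≤ ‖x‖ + ‖y‖ := norm_sub_le _ _
  have h2 : ‖x - y‖ ^ 2 ≤ (‖x‖ + ‖y‖) ^ 2 := pow_le_pow_left₀ (norm_nonneg _) h1 2
  have h3 : 2 * ‖x‖ * ‖y‖ ≤ η * ‖x‖ ^ 2 + η⁻¹ * ‖y‖ ^ 2 := by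
    have hkey : 0 ≤ (Real.sqrt η * ‖x‖ - (Real.sqrt η)⁻¹ * ‖y‖) ^ 2 := sq_nonneg _
    have hs : Real.sqrt η ^ 2 = η := Real.sq_sqrt hη.le
    have hs0 : 0 < Real.sqrt η := Real.sqrt_pos.2 hη
    have hsi : (Real.sqrt η)⁻¹ ^ 2 = η⁻¹ := by rw [inv_pow, hs]
    have hprod : Real.sqrt η * (Real.sqrt η)⁻¹ = 1 := mul_inv_cancel₀ hs0.ne'
    nlinarith [hkey, hs, hsi, hprod, norm_nonneg x, norm_nonneg y]
  nlinarith [h2, h3]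

section

variable {t : Fin 2 → (EuclideanSpace ℝ (Fin 3))} {A : (EuclideanSpace ℝ (Fin 3)) →L[ℝ] (EuclideanSpace ℝ (Fin 3))}
  {c₀ : EuclideanSpace ℝ (Fin 3)}

set_option quotPrecheck false in
-- local mass on the ball of radius `X` about `c₀`
local notation "𝐌[" f ", " X "]" =>
  tsum (fun p : Sites₀ t A => ‖f (p : EuclideanSpace ℝ (Fin 3))‖ ^ 2 * 𝟙ᵇ[p, c₀, X])

/-- **Splitting the mass of a difference**: if `k = f − g` pointwise then
`𝐌[k, X] ≤ (1 + η)𝐌[f, X] + (1 + η⁻¹)𝐌[g, X]`. [folklore] -/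
theorem mass_sub_le_split (hA : Adm₀ A) (hI : Inner₀ t A) (k f g : (EuclideanSpace ℝ (Fin 3)) → (EuclideanSpace ℝ (Fin 3)))
    (hk : ∀ x, k x = f x - g x) (X : ℝ) {η : ℝ} (hη : 0 < η) :
    𝐌[k, X] ≤ (1 + η) * 𝐌[f, X] + (1 + η⁻¹) * 𝐌[g, X] := by
  have hf := summable_normSq_indicator hA hI f c₀ X
  have hg := summable_normSq_indicator hA hI g c₀ X
  rw [← hf.tsum_mul_left, ← hg.tsum_mul_left, ← (hf.mul_left _).tsum_add (hg.mul_left _)]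
  refine (summable_normSq_indicator hA hI k c₀ X).tsum_le_tsum (fun p => ?_)
    ((hf.mul_left _).add (hg.mul_left _))
  have h := norm_sub_sq_le_eta (f p) (g p) hη
  rw [← hk] at h
  have h0 : 0 ≤ 𝟙ᵇ[p, c₀, X] := by split_ifs <;> norm_num
  calc ‖k (p : EuclideanSpace ℝ (Fin 3))‖ ^ 2 * 𝟙ᵇ[p, c₀, X]
      ≤ ((1 + η) * ‖f p‖ ^ 2 + (1 + η⁻¹) * ‖g p‖ ^ 2) * 𝟙ᵇ[p, c₀, X] := mul_le_mul_of_nonneg_right h h0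
    _ = (1 + η) * (‖f p‖ ^ 2 * 𝟙ᵇ[p, c₀, X]) + (1 + η⁻¹) * (‖g p‖ ^ 2 * 𝟙ᵇ[p, c₀, X]) := by ring

/-- **The total square sum dominates every local mass**: `𝐌[w, X] ≤ Σ'‖w‖²` for finitely supported `w`.
[folklore] -/
theorem mass_le_tsum_sq (hA : Adm₀ A) (hI : Inner₀ t A) {w : (EuclideanSpace ℝ (Fin 3)) → (EuclideanSpace ℝ (Fin 3))}
    (hw : (Function.support w).Finite) (X : ℝ) :
    𝐌[w, X] ≤ ∑' q : Sites₀ t A, ‖w q‖ ^ 2 := by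
  have h1 : Summable (fun q : Sites₀ t A => ‖w q‖ ^ 2) := by
    have := summable_normSq_mul_of_finite (t := t) (A := A) hw (fun _ => (1 : ℝ))
    simpa using this
  refine (summable_normSq_indicator hA hI w c₀ X).tsum_le_tsum (fun p => ?_) h1
  have h0 : 0 ≤ ‖w p‖ ^ 2 := sq_nonneg _
  split_ifs
  · rw [mul_one]
  · rw [mul_zero]; exact h0

/-- **Fresh masses near the centre**: if `‖v′ x + w x‖² ≤ 3(K(dist(x,c₀) + 11/10)²)² + 3 s²` at the sites of
`B_ρ(c₀)` (`K ≥ 0`) and `Σ'‖w‖² ≤ W`, then for `1 ≤ X ≤ ρ`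
`𝐌[v′, X] ≤ 2·(32 X³ (3(K(X + 11/10)²)² + 3 s²)) + 2 W`. [folklore] -/
theorem fresh_mass_le (hA : Adm₀ A) (hI : Inner₀ t A) (v' w : (EuclideanSpace ℝ (Fin 3)) → (EuclideanSpace ℝ (Fin 3)))
    (hw : (Function.support w).Finite) {ρ K s W : ℝ} (hK : 0 ≤ K)
    (hquart : ∀ x ∈ Sites₀ t A, dist x c₀ ≤ ρ → ‖v' x + w x‖ ^ 2 ≤ 3 * (K * (dist x c₀ + 11 / 10) ^ 2) ^ 2 + 3 * s ^ 2)
    (hW : ∑' q : Sites₀ t A, ‖w q‖ ^ 2 ≤ W) {X : ℝ} (hX1 : 1 ≤ X) (hXρ : X ≤ ρ) :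
    𝐌[v', X] ≤ 2 * (32 * X ^ 3 * (3 * (K * (X + 11 / 10) ^ 2) ^ 2 + 3 * s ^ 2)) + 2 * W := by
  have hf := summable_normSq_indicator hA hI (fun y => v' y + w y) c₀ X
  have hg := summable_normSq_indicator hA hI w c₀ X
  have hv := summable_normSq_indicator hA hI v' c₀ X
  -- pointwise: ‖v'‖² ≤ 2‖v' + w‖² + 2‖w‖²
  have hpt : ∀ p : Sites₀ t A, ‖v' (p : EuclideanSpace ℝ (Fin 3))‖ ^ 2 * 𝟙ᵇ[p, c₀, X] ≤
      2 * (‖(fun y => v' y + w y) (p : EuclideanSpace ℝ (Fin 3))‖ ^ 2 * 𝟙ᵇ[p, c₀, X]) +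
        2 * (‖w (p : EuclideanSpace ℝ (Fin 3))‖ ^ 2 * 𝟙ᵇ[p, c₀, X]) := by
    intro p
    have h1 : ‖v' (p : EuclideanSpace ℝ (Fin 3))‖ ≤ ‖v' (p : EuclideanSpace ℝ (Fin 3)) + w p‖ + ‖w p‖ := by
      have := norm_sub_le (v' (p : EuclideanSpace ℝ (Fin 3)) + w p) (w p)
      rwa [add_sub_cancel_right] at this
    have h2 : ‖v' (p : EuclideanSpace ℝ (Fin 3))‖ ^ 2 ≤ 2 * ‖v' (p : EuclideanSpace ℝ (Fin 3)) + w p‖ ^ 2 + 2 * ‖w p‖ ^ 2 := by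
      have h1' : ‖v' (p : EuclideanSpace ℝ (Fin 3))‖ ^ 2 ≤ (‖v' (p : EuclideanSpace ℝ (Fin 3)) + w p‖ + ‖w p‖) ^ 2 :=
        pow_le_pow_left₀ (norm_nonneg _) h1 2
      nlinarith [h1', sq_nonneg (‖v' (p : EuclideanSpace ℝ (Fin 3)) + w p‖ - ‖w (p : EuclideanSpace ℝ (Fin 3))‖)]
    have h0 : 0 ≤ 𝟙ᵇ[p, c₀, X] := by split_ifs <;> norm_num
    have := mul_le_mul_of_nonneg_right h2 h0
    simp only []
    linarith
  have hsum : 𝐌[v', X] ≤ 2 * 𝐌[(fun y => v' y + w y), X] + 2 * 𝐌[w, X] := by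
    rw [← hf.tsum_mul_left, ← hg.tsum_mul_left, ← (hf.mul_left _).tsum_add (hg.mul_left _)]
    exact hv.tsum_le_tsum hpt ((hf.mul_left _).add (hg.mul_left _))
  have hM1 : 𝐌[(fun y => v' y + w y), X] ≤ 32 * X ^ 3 * (Real.sqrt (3 * (K * (X + 11 / 10) ^ 2) ^ 2 + 3 * s ^ 2)) ^ 2 := by
    refine mass_le_of_pointwise hA hI (fun y => v' y + w y) hX1 fun x hx hxd => Real.le_sqrt_of_sq_le ?_
    refine (hquart x hx (hxd.trans hXρ)).trans ?_
    have hd0 : 0 ≤ dist x c₀ + 11 / 10 := by positivity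
    have hd1 : dist x c₀ + 11 / 10 ≤ X + 11 / 10 := by linarith
    have h3 : (dist x c₀ + 11 / 10) ^ 2 ≤ (X + 11 / 10) ^ 2 := pow_le_pow_left₀ hd0 hd1 2
    have h4 : K * (dist x c₀ + 11 / 10) ^ 2 ≤ K * (X + 11 / 10) ^ 2 := mul_le_mul_of_nonneg_left h3 hK
    have h5 : 0 ≤ K * (dist x c₀ + 11 / 10) ^ 2 := by positivity
    nlinarith [h4, h5]
  have hpos : 0 ≤ 3 * (K * (X + 11 / 10) ^ 2) ^ 2 + 3 * s ^ 2 := by positivity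
  rw [Real.sq_sqrt hpos] at hM1
  have hM2 := mass_le_tsum_sq hA hI hw X (c₀ := c₀)
  linarith [hsum, hM1, hM2, hW]

/-- **The value of the next step field at a site of `B_ρ(c₀)`** (used at the last scale only, where the volume
factor hidden in `‖w x₀‖² ≤ Σ'‖w‖² ≤ W` is affordable):
`‖v′ x₀‖ ≤ √(3(K(dist(x₀,c₀) + 11/10)²)² + 3s²) + √W`. [folklore] -/
theorem central_value_le (v' w : (EuclideanSpace ℝ (Fin 3)) → (EuclideanSpace ℝ (Fin 3)))
    (hw : (Function.support w).Finite) {ρ K s W : ℝ}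
    (hquart : ∀ x ∈ Sites₀ t A, dist x c₀ ≤ ρ → ‖v' x + w x‖ ^ 2 ≤ 3 * (K * (dist x c₀ + 11 / 10) ^ 2) ^ 2 + 3 * s ^ 2)
    (hW : ∑' q : Sites₀ t A, ‖w q‖ ^ 2 ≤ W) {x₀ : EuclideanSpace ℝ (Fin 3)} (hx₀ : x₀ ∈ Sites₀ t A) (hd : dist x₀ c₀ ≤ ρ) :
    ‖v' x₀‖ ≤ Real.sqrt (3 * (K * (dist x₀ c₀ + 11 / 10) ^ 2) ^ 2 + 3 * s ^ 2) + Real.sqrt W := by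
  have h1 : Summable (fun q : Sites₀ t A => ‖w q‖ ^ 2) := by
    have := summable_normSq_mul_of_finite (t := t) (A := A) hw (fun _ => (1 : ℝ))
    simpa using this
  have hwx : ‖w x₀‖ ^ 2 ≤ W := (h1.le_tsum ⟨x₀, hx₀⟩ (fun q _ => by positivity)).trans hW
  have hq := hquart x₀ hx₀ hd
  calc ‖v' x₀‖ = ‖(v' x₀ + w x₀) - w x₀‖ := by rw [add_sub_cancel_right]
    _ ≤ ‖v' x₀ + w x₀‖ + ‖w x₀‖ := norm_sub_le _ _
    _ ≤ _ := add_le_add (Real.le_sqrt_of_sq_le hq) (Real.le_sqrt_of_sq_le hwx)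

/-- **Mass of the cut-off increment**: for `|χ| ≤ 1`, Taylor data `aᵀ` (`‖aᵀ m‖ ≤ Vₐ`), `Bᵀ` based at `p₀`,
`dist p₀ c₀ ≤ 11/10`, and a sublattice shift `ξ`,
`𝐌[χ·(T + 𝟙_{S₀}ξ), X] ≤ 32 X³ (Vₐ + ‖ξ‖ + ‖Bᵀ‖(X + 11/10))²` for `X ≥ 1`. [folklore] -/
theorem incr_mass_le (hA : Adm₀ A) (hI : Inner₀ t A) (χ : EuclideanSpace ℝ (Fin 3) → ℝ) (hχabs : ∀ x, |χ x| ≤ 1)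
    (aT : Fin 2 → EuclideanSpace ℝ (Fin 3)) (BT : (EuclideanSpace ℝ (Fin 3)) →L[ℝ] (EuclideanSpace ℝ (Fin 3)))
    (ξ p₀ : EuclideanSpace ℝ (Fin 3)) {Va : ℝ} (hVa : ∀ m, ‖aT m‖ ≤ Va) (hp₀ : dist p₀ c₀ ≤ 11 / 10)
    {X : ℝ} (hX1 : 1 ≤ X) :
    𝐌[(fun x => χ x • (((if (∃ z ∈ Λ₀, x = t 1 + A z) then aT 1 else aT 0) + BT (x - p₀)) +
        (if (∃ z ∈ Λ₀, x = t 0 + A z) then ξ else 0))), X] ≤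
      32 * X ^ 3 * (Va + ‖ξ‖ + ‖BT‖ * (X + 11 / 10)) ^ 2 := by
  refine mass_le_of_pointwise hA hI (fun x => χ x • (((if (∃ z ∈ Λ₀, x = t 1 + A z) then aT 1 else aT 0) + BT (x - p₀)) +
        (if (∃ z ∈ Λ₀, x = t 0 + A z) then ξ else 0))) hX1 fun x _ hxd => ?_
  -- the three pieces
  have hT : ‖(if (∃ z ∈ Λ₀, x = t 1 + A z) then aT 1 else aT 0)‖ ≤ Va := by
    by_cases h : ∃ z ∈ Λ₀, x = t 1 + A z
    · rw [if_pos h]; exact hVa 1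
    · rw [if_neg h]; exact hVa 0
  have hσ : ‖(if (∃ z ∈ Λ₀, x = t 0 + A z) then ξ else (0 : EuclideanSpace ℝ (Fin 3)))‖ ≤ ‖ξ‖ := by
    by_cases h : ∃ z ∈ Λ₀, x = t 0 + A z
    · rw [if_pos h]
    · rw [if_neg h, norm_zero]; exact norm_nonneg _
  have hB : ‖BT (x - p₀)‖ ≤ ‖BT‖ * (X + 11 / 10) := by
    refine (BT.le_opNorm _).trans (mul_le_mul_of_nonneg_left ?_ (norm_nonneg _))
    rw [← dist_eq_norm]
    have h1 := dist_triangle x c₀ p₀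
    rw [dist_comm c₀ p₀] at h1
    linarith
  have hI' : ‖((if (∃ z ∈ Λ₀, x = t 1 + A z) then aT 1 else aT 0) + BT (x - p₀)) +
      (if (∃ z ∈ Λ₀, x = t 0 + A z) then ξ else 0)‖ ≤ Va + ‖ξ‖ + ‖BT‖ * (X + 11 / 10) := by
    refine (norm_add_le _ _).trans ?_
    have h2 := norm_add_le (if (∃ z ∈ Λ₀, x = t 1 + A z) then aT 1 else aT 0) (BT (x - p₀))
    linarith
  have hχx : |χ x| ≤ 1 := hχabs x
  have hn0 : 0 ≤ ‖((if (∃ z ∈ Λ₀, x = t 1 + A z) then aT 1 else aT 0) + BT (x - p₀)) +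
      (if (∃ z ∈ Λ₀, x = t 0 + A z) then ξ else 0)‖ := norm_nonneg _
  rw [norm_smul, Real.norm_eq_abs]
  calc |χ x| * ‖((if (∃ z ∈ Λ₀, x = t 1 + A z) then aT 1 else aT 0) + BT (x - p₀)) +
        (if (∃ z ∈ Λ₀, x = t 0 + A z) then ξ else 0)‖
      ≤ 1 * ‖((if (∃ z ∈ Λ₀, x = t 1 + A z) then aT 1 else aT 0) + BT (x - p₀)) +
        (if (∃ z ∈ Λ₀, x = t 0 + A z) then ξ else 0)‖ := mul_le_mul_of_nonneg_right hχx hn0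
    _ ≤ Va + ‖ξ‖ + ‖BT‖ * (X + 11 / 10) := by rw [one_mul]; exact hI'

/-- **The next step field is the old one minus the cut-off increment** (pointwise algebra):
`χ(x)((πx − x) − (aff x + I x)) = χ(x)((πx − x) − aff x) − χ(x) I x`. [folklore] -/
theorem next_field_eq (χ : EuclideanSpace ℝ (Fin 3) → ℝ) (π aff I : (EuclideanSpace ℝ (Fin 3)) → (EuclideanSpace ℝ (Fin 3)))
    (x : EuclideanSpace ℝ (Fin 3)) :
    χ x • ((π x - x) - (aff x + I x)) = χ x • ((π x - x) - aff x) - χ x • I x := by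
  rw [← smul_sub]; congr 1; abel

/-- **Propagated masses away from the centre**: with the increment bound of `incr_mass_le`,
`𝐌[v′, X] ≤ (1+η)𝐌[v, X] + (1+η⁻¹)·32X³(Vₐ + ‖ξ‖ + ‖Bᵀ‖(X + 11/10))²`. [folklore] -/
theorem propagated_mass_le (hA : Adm₀ A) (hI : Inner₀ t A) (χ : EuclideanSpace ℝ (Fin 3) → ℝ) (hχabs : ∀ x, |χ x| ≤ 1)
    (π aff : (EuclideanSpace ℝ (Fin 3)) → (EuclideanSpace ℝ (Fin 3)))
    (aT : Fin 2 → EuclideanSpace ℝ (Fin 3)) (BT : (EuclideanSpace ℝ (Fin 3)) →L[ℝ] (EuclideanSpace ℝ (Fin 3)))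
    (ξ p₀ : EuclideanSpace ℝ (Fin 3)) {Va : ℝ} (hVa : ∀ m, ‖aT m‖ ≤ Va) (hp₀ : dist p₀ c₀ ≤ 11 / 10)
    {X η : ℝ} (hX1 : 1 ≤ X) (hη : 0 < η) :
    𝐌[(fun x => χ x • ((π x - x) - (aff x + (((if (∃ z ∈ Λ₀, x = t 1 + A z) then aT 1 else aT 0) + BT (x - p₀)) +
        (if (∃ z ∈ Λ₀, x = t 0 + A z) then ξ else 0))))), X] ≤
      (1 + η) * 𝐌[(fun x => χ x • ((π x - x) - aff x)), X] +
        (1 + η⁻¹) * (32 * X ^ 3 * (Va + ‖ξ‖ + ‖BT‖ * (X + 11 / 10)) ^ 2) := by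
  have hincr := incr_mass_le hA hI χ hχabs aT BT ξ p₀ hVa hp₀ hX1 (c₀ := c₀)
  have hsplit := mass_sub_le_split hA hI
    (fun x => χ x • ((π x - x) - (aff x + (((if (∃ z ∈ Λ₀, x = t 1 + A z) then aT 1 else aT 0) + BT (x - p₀)) +
        (if (∃ z ∈ Λ₀, x = t 0 + A z) then ξ else 0)))))
    (fun x => χ x • ((π x - x) - aff x))
    (fun x => χ x • (((if (∃ z ∈ Λ₀, x = t 1 + A z) then aT 1 else aT 0) + BT (x - p₀)) +
        (if (∃ z ∈ Λ₀, x = t 0 + A z) then ξ else 0)))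
    (fun x => next_field_eq χ π aff (fun y => ((if (∃ z ∈ Λ₀, y = t 1 + A z) then aT 1 else aT 0) + BT (y - p₀)) +
        (if (∃ z ∈ Λ₀, y = t 0 + A z) then ξ else 0)) x) X (c₀ := c₀) hη
  have hη1 : 0 ≤ 1 + η⁻¹ := by positivity
  exact hsplit.trans (add_le_add le_rfl (mul_le_mul_of_nonneg_left hincr hη1))

end

end Summit.AtomisticToContinuum.Crystallization.Theorems.ExcessDecayLiouville

end
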